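import Summits.CriticalPhenomena.PercolationContinuityZ3.Theorems.PercNearOneGluingAdditiveGluingAL5QTransfer
import Summits.CriticalPhenomena.PercolationContinuityZ3.Theorems.PercNearOneGluingAdditiveGluingAL5LayerCake
import Summits.CriticalPhenomena.PercolationContinuityZ3.Theorems.PercNearOneGluingAdditiveGluingAL5HalfOdds
import HarnessLib

/-! # Crux `PercNearOneGluing.AdditiveGluing` (stmt-CriticalPhenomena-4576) — AL5 for every block and every relay set,
# part C: the transfer step for the UP-SET inequalities of a star

Support file (`--supports stmt-CriticalPhenomena-4576`; task png-dp-al5, gen 2); no definitions, no named facts.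
`μ_u = prodBernoulli u`; bystander `x`, target `b`, a finite set `F` of pairs at `x` (a STAR: each `e ∈ F` is `s(x,a)`, `a ≠ x`);
for a pattern `J ⊆ F` the pinned weighting `u_J = pinW u F J` (`1` on `J`, `0` on `F ∖ J`), the pattern weight
`π_J(u) = ∏_{e∈J} u e ∏_{e∈F∖J} (1 − u e)` and the margin `M(v) = μ_v(x↔b) − μ_v(d↔b)`.  The UP-SET PROPERTY UPS(u, F) says:
for every up-closed family `𝒰` of nonempty patterns, `Σ_{J∈𝒰} π_J(u) M(u_J) ≥ 0` — i.e. `μ_u(Q ∩ d↔b) ≤ μ_u(Q ∩ x↔b)` for every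
increasing event `Q` of the star; `𝒰 = {all nonempty}` is the multi-edge Lemma 3 (`multiEdge_lemma3`).  It is written out in full
in every statement (no definitions in support files).

* `al5u_transfer` — **the transfer step.**  `e = s(x,y)` a further pair at `x` (`y ≠ x`, `e ∉ F`, `d ≠ x`), `u¹ = u[e ↦ 1]`,
  `p ∈ [0,1]`, `𝒰₀ ⊆ 𝒰₁` up-closed families of nonempty patterns.  If UPS(u, F) then
  `0 ≤ Σ_{J∈𝒰₀} π_J M(u_J) + p Σ_{J∈𝒰₁∖𝒰₀} π_J M(u¹_J)`.
  (`al5lc_transfer_abstract` fed with `al5q_transfer`, `al5q_factor_mono` and the monotonicity of `μ(d ↮ x)` in the weights.)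
* `al5u_sum_nonempty_eq` — the pattern expansion `Σ_{∅≠J⊆F} π_J M(u_J) = μ_u(R ∩ x↔b) − μ_u(R ∩ d↔b)`, `R` = "some pair of `F` open".
[cite: KozmaNitzan2024, Lemma 3(i) (pp. 6–7), Lemma 5 (p. 13), §4 p. 20; VandenbergHaggstromKahn2005, Thms. 1.3–1.4]
-/

namespace Summit.CriticalPhenomena.PercolationContinuityZ3.Theorems

open MeasureTheory Set
open Literature.Probability.LatticeModels (prodBernoulli)
open Literature.Probability.Percolation (BondConfig openConn openGraph openEdgeCluster pinW localCylinder
  DeterminedBy determinedBy_iff)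

noncomputable section
open Classical

section AL5UpsetTransfer

open Filter Topology Literature.Probability.LatticeModels Literature.Probability.Percolation

variable {n : ℕ}

/-- Pattern weights are nonnegative. [folklore] -/
theorem al5u_pi_nonneg (u : Sym2 (Fin n) → unitInterval) (F J : Finset (Sym2 (Fin n))) :
    0 ≤ (∏ e ∈ J, (u e : ℝ)) * ∏ e ∈ F \ J, (1 - (u e : ℝ)) :=
  mul_nonneg (Finset.prod_nonneg fun _ _ => unitInterval.nonneg _)
    (Finset.prod_nonneg fun _ _ => sub_nonneg.2 (unitInterval.le_one _))

/-- `μ(x↔b) ≤ μ(d↔b) + μ(d↮x)` and `μ(d↔b) ≤ μ(x↔b) + μ(d↮x)`: off `{d ↮ x}` the two events agree; hence the margin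
`M(v)` vanishes when `μ_v(d ↮ x) = 0`. [folklore] -/
theorem al5u_margin_eq_zero (v : Sym2 (Fin n) → unitInterval) (x d b : Fin n)
    (h0 : (prodBernoulli v).real (openConn d x)ᶜ = 0) :
    (prodBernoulli v).real (openConn x b) - (prodBernoulli v).real (openConn d b) = 0 := by
  have h1 : (prodBernoulli v).real (openConn x b) ≤ (prodBernoulli v).real (openConn d b) + (prodBernoulli v).real (openConn d x)ᶜ := by
    calc (prodBernoulli v).real (openConn x b) ≤ (prodBernoulli v).real (openConn d b ∪ (openConn d x)ᶜ) := by
          refine measureReal_mono (fun ω hω => ?_)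
          by_cases h : ω ∈ (openConn d x : Set (BondConfig (Fin n)))
          · exact Or.inl (show (openGraph ω).Reachable d b from SimpleGraph.Reachable.trans h hω)
          · exact Or.inr h
      _ ≤ _ := measureReal_union_le _ _
  have h2 : (prodBernoulli v).real (openConn d b) ≤ (prodBernoulli v).real (openConn x b) + (prodBernoulli v).real (openConn d x)ᶜ := by
    calc (prodBernoulli v).real (openConn d b) ≤ (prodBernoulli v).real (openConn x b ∪ (openConn d x)ᶜ) := by
          refine measureReal_mono (fun ω hω => ?_)
          by_cases h : ω ∈ (openConn d x : Set (BondConfig (Fin n)))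
          · exact Or.inl (show (openGraph ω).Reachable x b from SimpleGraph.Reachable.trans (SimpleGraph.Reachable.symm h) hω)
          · exact Or.inr h
      _ ≤ _ := measureReal_union_le _ _
  rw [h0] at h1 h2
  linarith

/-- Raising weights lowers `μ(d ↮ x)`. [folklore] -/
theorem al5u_notConn_anti {v v' : Sym2 (Fin n) → unitInterval} (h : v ≤ v') (d x : Fin n) :
    (prodBernoulli v').real (openConn d x)ᶜ ≤ (prodBernoulli v).real (openConn d x)ᶜ := by
  have hm : MeasurableSet (openConn d x : Set (BondConfig (Fin n))) := MeasurableSet.of_discrete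
  rw [probReal_compl_eq_one_sub hm, probReal_compl_eq_one_sub hm]
  linarith [prodBernoulli_real_mono_of_isUpperSet h (isUpperSet_openConn d x) hm]

/-- Pinned weightings are monotone in the pattern. [folklore] -/
theorem al5u_pinW_mono (u : Sym2 (Fin n) → unitInterval) (F : Finset (Sym2 (Fin n))) {J J' : Finset (Sym2 (Fin n))}
    (hJJ' : J ⊆ J') : pinW u (↑F : Set (Sym2 (Fin n))) ↑J ≤ pinW u ↑F ↑J' := by
  intro e
  by_cases heF : e ∈ (↑F : Set (Sym2 (Fin n)))
  · by_cases heJ : e ∈ (↑J : Set (Sym2 (Fin n)))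
    · rw [pinW_apply_of_mem_of_mem u heF heJ, pinW_apply_of_mem_of_mem u heF (Finset.mem_coe.2 (hJJ' (Finset.mem_coe.1 heJ)))]
    · rw [pinW_apply_of_mem_of_not_mem u heF heJ]; exact unitInterval.nonneg _
  · rw [pinW_apply_of_not_mem u _ heF, pinW_apply_of_not_mem u _ heF]

/-- Gluing a pair raises the weighting. [folklore] -/
theorem al5u_le_glue (v : Sym2 (Fin n) → unitInterval) (e : Sym2 (Fin n)) :
    v ≤ fun e' : Sym2 (Fin n) => if e' = e then 1 else v e' := by
  intro e'
  by_cases h : e' = e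
  · simp only [h, if_true]; exact unitInterval.le_one _
  · simp only [h, if_false, le_refl]

/-- Pinning on `F` commutes with gluing a pair off `F`. [folklore] -/
theorem al5u_pinW_glue_comm (u : Sym2 (Fin n) → unitInterval) (F : Finset (Sym2 (Fin n))) {e : Sym2 (Fin n)} (heF : e ∉ F)
    (J : Finset (Sym2 (Fin n))) :
    pinW (fun e' : Sym2 (Fin n) => if e' = e then 1 else u e') (↑F : Set (Sym2 (Fin n))) ↑J =
      fun e' : Sym2 (Fin n) => if e' = e then 1 else pinW u (↑F : Set (Sym2 (Fin n))) ↑J e' := by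
  funext e'
  by_cases he : e' = e
  · subst he
    have heF' : e' ∉ (↑F : Set (Sym2 (Fin n))) := fun h => heF (Finset.mem_coe.1 h)
    rw [pinW_apply_of_not_mem _ _ heF', if_pos rfl, if_pos rfl]
  · rw [if_neg he]
    by_cases heF' : e' ∈ (↑F : Set (Sym2 (Fin n)))
    · by_cases heJ : e' ∈ (↑J : Set (Sym2 (Fin n)))
      · rw [pinW_apply_of_mem_of_mem _ heF' heJ, pinW_apply_of_mem_of_mem _ heF' heJ]
      · rw [pinW_apply_of_mem_of_not_mem _ heF' heJ, pinW_apply_of_mem_of_not_mem _ heF' heJ]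
    · rw [pinW_apply_of_not_mem _ _ heF', pinW_apply_of_not_mem _ _ heF', if_neg he]

/-- For patterns `J ⊆ J' ⊆ F` of a star at `x`, gluing the star `x–Z` with `Z` the far endpoints of `J' ∖ J` turns `u_J` into `u_{J'}`.
[folklore] -/
theorem al5u_pinW_glueStar_eq (u : Sym2 (Fin n) → unitInterval) (x : Fin n) (F : Finset (Sym2 (Fin n)))
    (hF : ∀ e ∈ F, ∃ a, a ≠ x ∧ e = s(x, a)) {J J' : Finset (Sym2 (Fin n))} (hJJ' : J ⊆ J') (hJ'F : J' ⊆ F) :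
    (fun e' : Sym2 (Fin n) => if e' ∈ (Finset.univ.filter (fun z : Fin n => z ≠ x ∧ s(x, z) ∈ J' \ J)).image (fun z => s(x, z))
        then 1 else pinW u (↑F : Set (Sym2 (Fin n))) ↑J e') = pinW u (↑F : Set (Sym2 (Fin n))) ↑J' := by
  have himg : ∀ e' : Sym2 (Fin n),
      e' ∈ (Finset.univ.filter (fun z : Fin n => z ≠ x ∧ s(x, z) ∈ J' \ J)).image (fun z => s(x, z)) ↔ e' ∈ J' \ J := by
    intro e'
    constructor
    · intro h
      obtain ⟨z, hz, rfl⟩ := Finset.mem_image.1 h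
      exact (Finset.mem_filter.1 hz).2.2
    · intro h
      obtain ⟨a, hax, rfl⟩ := hF e' (hJ'F (Finset.mem_sdiff.1 h).1)
      exact Finset.mem_image.2 ⟨a, Finset.mem_filter.2 ⟨Finset.mem_univ _, hax, h⟩, rfl⟩
  funext e'
  by_cases h : e' ∈ J' \ J
  · rw [if_pos ((himg e').2 h)]
    obtain ⟨h1, _⟩ := Finset.mem_sdiff.1 h
    rw [pinW_apply_of_mem_of_mem u (Finset.mem_coe.2 (hJ'F h1)) (Finset.mem_coe.2 h1)]
  · rw [if_neg (fun h' => h ((himg e').1 h'))]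
    by_cases heF : e' ∈ (↑F : Set (Sym2 (Fin n)))
    · by_cases heJ : e' ∈ (↑J : Set (Sym2 (Fin n)))
      · rw [pinW_apply_of_mem_of_mem u heF heJ,
          pinW_apply_of_mem_of_mem u heF (Finset.mem_coe.2 (hJJ' (Finset.mem_coe.1 heJ)))]
      · have heJ' : e' ∉ (↑J' : Set (Sym2 (Fin n))) := fun h' =>
          h (Finset.mem_sdiff.2 ⟨Finset.mem_coe.1 h', fun h'' => heJ (Finset.mem_coe.2 h'')⟩)
        rw [pinW_apply_of_mem_of_not_mem u heF heJ, pinW_apply_of_mem_of_not_mem u heF heJ']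
    · rw [pinW_apply_of_not_mem u _ heF, pinW_apply_of_not_mem u _ heF]

/-- **The transfer step** (see the module docstring): UPS(`u`, `F`) implies the mixed inequality
`0 ≤ Σ_{J∈𝒰₀} π_J M(u_J) + p Σ_{J∈𝒰₁∖𝒰₀} π_J M(u[e↦1]_J)` for the further pair `e = s(x,y)` at `x`.
[cite: KozmaNitzan2024, Lemma 3(i) (pp. 6–7); VandenbergHaggstromKahn2005, Thms. 1.3–1.4] -/
theorem al5u_transfer (u : Sym2 (Fin n) → unitInterval) (x y d b : Fin n) (F : Finset (Sym2 (Fin n)))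
    (hF : ∀ e ∈ F, ∃ a, a ≠ x ∧ e = s(x, a)) (hyx : y ≠ x) (hyF : s(x, y) ∉ F) (hdx : d ≠ x)
    (hUPS : ∀ 𝒰 : Finset (Finset (Sym2 (Fin n))), 𝒰 ⊆ F.powerset → (∀ J ∈ 𝒰, J.Nonempty) →
      (∀ J ∈ 𝒰, ∀ J', J ⊆ J' → J' ⊆ F → J' ∈ 𝒰) →
      0 ≤ ∑ J ∈ 𝒰, ((∏ e ∈ J, (u e : ℝ)) * ∏ e ∈ F \ J, (1 - (u e : ℝ))) *
        ((prodBernoulli (pinW u ↑F ↑J)).real (openConn x b) - (prodBernoulli (pinW u ↑F ↑J)).real (openConn d b)))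
    (𝒰₀ 𝒰₁ : Finset (Finset (Sym2 (Fin n)))) (h01 : 𝒰₀ ⊆ 𝒰₁) (h1F : 𝒰₁ ⊆ F.powerset)
    (hne : ∀ J ∈ 𝒰₁, J.Nonempty) (hup0 : ∀ J ∈ 𝒰₀, ∀ J', J ⊆ J' → J' ⊆ F → J' ∈ 𝒰₀)
    (hup1 : ∀ J ∈ 𝒰₁, ∀ J', J ⊆ J' → J' ⊆ F → J' ∈ 𝒰₁) (p : ℝ) (hp0 : 0 ≤ p) (hp1 : p ≤ 1) :
    0 ≤ ∑ J ∈ 𝒰₀, ((∏ e ∈ J, (u e : ℝ)) * ∏ e ∈ F \ J, (1 - (u e : ℝ))) *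
          ((prodBernoulli (pinW u ↑F ↑J)).real (openConn x b) - (prodBernoulli (pinW u ↑F ↑J)).real (openConn d b)) +
      p * ∑ J ∈ 𝒰₁ \ 𝒰₀, ((∏ e ∈ J, (u e : ℝ)) * ∏ e ∈ F \ J, (1 - (u e : ℝ))) *
          ((prodBernoulli (pinW (fun e' : Sym2 (Fin n) => if e' = s(x, y) then 1 else u e') ↑F ↑J)).real (openConn x b) -
            (prodBernoulli (pinW (fun e' : Sym2 (Fin n) => if e' = s(x, y) then 1 else u e') ↑F ↑J)).real (openConn d b)) := by
  set e : Sym2 (Fin n) := s(x, y) with he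
  set u1 : Sym2 (Fin n) → unitInterval := fun e' => if e' = e then 1 else u e' with hu1
  set N : Set (BondConfig (Fin n)) := (openConn d x)ᶜ with hN
  -- the data of the abstract transfer step
  set π : Finset (Sym2 (Fin n)) → ℝ := fun J => (∏ e ∈ J, (u e : ℝ)) * ∏ e ∈ F \ J, (1 - (u e : ℝ)) with hπ
  set M : (Sym2 (Fin n) → unitInterval) → ℝ := fun v => (prodBernoulli v).real (openConn x b) - (prodBernoulli v).real (openConn d b)
    with hM
  set z : Finset (Sym2 (Fin n)) → ℝ := fun J => π J * M (pinW u ↑F ↑J) with hz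
  set g : Finset (Sym2 (Fin n)) → ℝ := fun J => π J * M (pinW u1 ↑F ↑J) with hg
  set ν : Finset (Sym2 (Fin n)) → ℝ := fun J => (prodBernoulli (pinW u ↑F ↑J)).real N with hν
  set ν₁ : Finset (Sym2 (Fin n)) → ℝ := fun J => (prodBernoulli (pinW u1 ↑F ↑J)).real N with hν₁
  have hcomm : ∀ J : Finset (Sym2 (Fin n)), pinW u1 (↑F : Set (Sym2 (Fin n))) ↑J =
      fun e' : Sym2 (Fin n) => if e' = e then 1 else pinW u ↑F ↑J e' := fun J => al5u_pinW_glue_comm u F hyF J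
  have key := al5lc_transfer_abstract F z g ν ν₁ ?_ ?_ ?_ ?_ ?_ ?_ ?_ ?_ 𝒰₀ 𝒰₁ h01 h1F hne hup0 hup1 p hp0 hp1
  · simpa only [hz, hg] using key
  · intro J _; exact measureReal_nonneg
  · intro J _
    simp only [hν, hν₁, hcomm J]
    exact al5u_notConn_anti (al5u_le_glue _ e) d x
  · intro J J' hJJ' _
    simp only [hν]
    exact al5u_notConn_anti (al5u_pinW_mono u F hJJ') d x
  · intro J _
    simp only [hν, hν₁, hz, hg, hM, hcomm J]
    have hq := al5q_transfer (pinW u ↑F ↑J) x y d b hyx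
    have hπ0 : 0 ≤ π J := al5u_pi_nonneg u F J
    nlinarith [hq, hπ0]
  · intro J _ h0
    simp only [hz, hM, al5u_margin_eq_zero (pinW u ↑F ↑J) x d b h0, mul_zero]
  · intro J _ h0
    simp only [hg, hM, al5u_margin_eq_zero (pinW u1 ↑F ↑J) x d b h0, mul_zero]
  · intro J J' hJJ' hJ'F
    simp only [hν, hν₁, hcomm J, hcomm J']
    set Z : Finset (Fin n) := Finset.univ.filter (fun z : Fin n => z ≠ x ∧ s(x, z) ∈ J' \ J) with hZ
    have hyZ : y ∉ Z := fun h => hyF (hJ'F (Finset.mem_sdiff.1 (Finset.mem_filter.1 h).2.2).1)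
    have hmono := al5q_factor_mono (pinW u ↑F ↑J) x y d Z hyx hyZ hdx
    have hZeq := al5u_pinW_glueStar_eq u x F hF hJJ' hJ'F
    have hfun : (fun e' : Sym2 (Fin n) => if e' = s(x, y) then (1 : unitInterval) else
        (if e' ∈ Z.image (fun z => s(x, z)) then 1 else pinW u (↑F : Set (Sym2 (Fin n))) ↑J e')) =
        fun e' : Sym2 (Fin n) => if e' = s(x, y) then 1 else pinW u (↑F : Set (Sym2 (Fin n))) ↑J' e' := by
      funext e'
      by_cases hc : e' = s(x, y)
      · rw [if_pos hc, if_pos hc]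
      · rw [if_neg hc, if_neg hc]
        exact congrFun hZeq e'
    rw [hfun, hZeq] at hmono
    exact hmono
  · exact hUPS

/-- **Pattern expansion of the margin on "some pair of `F` open".**  For any finite set `F` of pairs:
`Σ_{∅ ≠ J ⊆ F} π_J(u) M(u_J) = μ_u(R ∩ x↔b) − μ_u(R ∩ d↔b)`, `R = {ω | ∃ e ∈ F, e ∈ ω}`.
[cite: KozmaNitzan2024, §4 p. 20 (law of total probability over the patterns)] -/
theorem al5u_sum_nonempty_eq (u : Sym2 (Fin n) → unitInterval) (x d b : Fin n) (F : Finset (Sym2 (Fin n))) :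
    ∑ J ∈ F.powerset.filter (fun J => J.Nonempty), ((∏ e ∈ J, (u e : ℝ)) * ∏ e ∈ F \ J, (1 - (u e : ℝ))) *
        ((prodBernoulli (pinW u ↑F ↑J)).real (openConn x b) - (prodBernoulli (pinW u ↑F ↑J)).real (openConn d b)) =
      (prodBernoulli u).real ({ω : Set (Sym2 (Fin n)) | ∃ e ∈ F, e ∈ ω} ∩ openConn x b) -
        (prodBernoulli u).real ({ω : Set (Sym2 (Fin n)) | ∃ e ∈ F, e ∈ ω} ∩ openConn d b) := by
  set R : Set (Set (Sym2 (Fin n))) := {ω | ∃ e ∈ F, e ∈ ω} with hRdef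
  have hdec := fun v : Fin n =>
    prodBernoulli_real_inter_eq_sum_pinW u F (A := openConn v b) (B := R) MeasurableSet.of_discrete
      (DepthOneGluing.determinedBy_exists_mem F)
  have hRiff : ∀ J ∈ F.powerset, ((↑J : Set (Sym2 (Fin n))) ∈ R ↔ J.Nonempty) := by
    intro J hJ
    have hJF : J ⊆ F := Finset.mem_powerset.1 hJ
    simp only [hRdef, Set.mem_setOf_eq, Finset.mem_coe]
    exact ⟨fun ⟨e, _, heJ⟩ => ⟨e, heJ⟩, fun ⟨e, heJ⟩ => ⟨e, hJF heJ, heJ⟩⟩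
  rw [Set.inter_comm R (openConn x b), Set.inter_comm R (openConn d b), hdec x, hdec d, ← Finset.sum_sub_distrib,
    Finset.sum_filter, Finset.sum_filter]
  refine Finset.sum_congr rfl fun J hJ => ?_
  have hJF : J ⊆ F := Finset.mem_powerset.1 hJ
  by_cases hne : J.Nonempty
  · rw [if_pos hne, if_pos ((hRiff J hJ).2 hne), halfOdds_real_localCylinder u hJF]
    ring
  · rw [if_neg hne, if_neg (fun h => hne ((hRiff J hJ).1 h))]

end AL5UpsetTransfer

end

end Summit.CriticalPhenomena.PercolationContinuityZ3.Theorems
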